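import Summits.Ventures.HSemireg.WedgeHankelRecurrencePartialFractions
import Summits.Ventures.HSemireg.WedgeHankelRecurrencePeriod

/-!
# Venture HSemireg — PERIODS OF A SUM OF EXPONENTIALS: for DISTINCT nodes `λ_i` and NON-ZERO weights `A_i` the partial-fraction symbol of `Σ_i A_i λ_i^j` (N84) is REDUCED
# (`gcd(∏ (X − λ_i), Σ_i A_i ∏_{k ≠ i} (X − λ_k)) = 1`), hence **`(Σ_i A_i λ_i^j)_j` is `T`-periodic iff every node is a `T`-th root of unity, `λ_i^T = 1`** (any field)
# («a sum of `r` distinct geometric progressions is periodic of period `T` iff all ratios are `T`-th roots of unity»)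

HONEST FRAMING. Part of the Lean index of the computation cell `pub-hsemireg` (seat p10 gen 30, Sunday typer «UNIFORM-IN-n»).
LINEAR ALGEBRA OF HANKEL (catalecticant) MATRICES and of polynomials over a field ONLY (`Lagrange.nodal`, `Polynomial.modByMonic`): no variety, no cohomology theory, no sheaf, no Ext group
and no semiregularity map is constructed here; nothing here says that HC / HC_CM / HC_AV holds; no Literature fact is declared or used.  Custodian versions as in `WedgeHankelSiegelIdeal` (1/3).

WHAT IS IN THE TREE.  N84 (`WedgeHankelRecurrencePartialFractions`): `sum_mul_pow_eq_dualSeq_nodal` (`(Σ_{i∈s} A_i λ_i^j)_j = dualSeq (nodal s λ) (Σ_{i∈s} C(A_i)·nodal (s∖i) λ)`), `secSeq_eq_dualSeq_nodal`.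
N81 (`WedgeHankelRecurrencePeriod`): `periodic_dualSeq_iff_dvd` (reduced `a/m`: `T`-periodic ↔ `m ∣ X^T − 1`).  Mathlib: `Lagrange.nodal`, `Lagrange.nodal_monic`, `Lagrange.eval_nodal_at_node`,
`Lagrange.eval_nodal_not_at_node`, `Lagrange.X_sub_C_dvd_nodal`, `IsCoprime.prod_left_iff`, `Finset.prod_dvd_of_coprime`, `Polynomial.dvd_iff_isRoot`, `Polynomial.irreducible_X_sub_C`,
`Polynomial.isCoprime_X_sub_C_of_isUnit_sub`.
THIS FILE (namespace `Summit.Ventures.HSemireg.Wedge.HankelOuter` continued; PLAIN on N84 + N81; 0 definitions; every statement over an ARBITRARY field):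
* §646 `eval_sum_C_mul_nodal_erase` (the numerator of N84's symbol takes the value `A_i·∏_{k≠i}(λ_i − λ_k)` at the node `λ_i`), **`isCoprime_nodal_sum_C_mul_nodal_erase`** (distinct nodes, non-zero
  weights ⇒ THE SYMBOL IS REDUCED), `nodal_dvd_X_pow_sub_one_iff` (distinct nodes: `∏ (X − λ_i) ∣ X^T − 1 ↔ ∀ i, λ_i^T = 1`), **`periodic_sum_mul_pow_iff`** (`Finset` form) and
  **`periodic_secSeq_iff`** (`Fin r` form: `secSeq A λ` is `T`-periodic ↔ `∀ i, λ_i^T = 1`).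
Nothing Ext-side.  New names only.
-/

open Module Polynomial
open scoped Matrix Polynomial

namespace Summit.Ventures.HSemireg.Wedge.HankelOuter

open Summit.Ventures.HSemireg.Wedge Summit.Ventures.HSemireg.Wedge.Hankel Summit.Ventures.HSemireg.Wedge.HankelSecant

variable (K : Type*) [Field K]

/-! ## §646. Periods of a sum of exponentials -/

/-- the numerator `Σ_j C(A_j)·nodal (s∖j) λ` of N84's symbol evaluates at the node `λ_i` (`i ∈ s`) to `A_i · (nodal (s∖i) λ)(λ_i)` (all other summands vanish there). Any nodes. -/
theorem eval_sum_C_mul_nodal_erase {ι : Type*} [DecidableEq ι] (s : Finset ι) (lam A : ι → K) {i : ι} (hi : i ∈ s) :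
    (∑ j ∈ s, C (A j) * Lagrange.nodal (s.erase j) lam).eval (lam i) = A i * (Lagrange.nodal (s.erase i) lam).eval (lam i) := by
  rw [Polynomial.eval_finsetSum, Finset.sum_eq_single_of_mem i hi]
  · rw [Polynomial.eval_mul, Polynomial.eval_C]
  · intro j _ hji
    rw [Polynomial.eval_mul, Polynomial.eval_C, Lagrange.eval_nodal_at_node (Finset.mem_erase.mpr ⟨fun h => hji h.symm, hi⟩), mul_zero]

/-- **DISTINCT NODES AND NON-ZERO WEIGHTS ⇒ THE SYMBOL IS REDUCED**: `gcd(nodal s λ, Σ_j C(A_j)·nodal (s∖j) λ) = 1` when `λ` is injective on `s` and every `A_i ≠ 0` (the numerator does not vanish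
at any node). Any field. -/
theorem isCoprime_nodal_sum_C_mul_nodal_erase {ι : Type*} [DecidableEq ι] (s : Finset ι) (lam A : ι → K) (hinj : Set.InjOn lam s) (hA : ∀ i ∈ s, A i ≠ 0) :
    IsCoprime (Lagrange.nodal s lam) (∑ j ∈ s, C (A j) * Lagrange.nodal (s.erase j) lam) := by
  rw [Lagrange.nodal, IsCoprime.prod_left_iff]
  intro i hi
  refine (Polynomial.irreducible_X_sub_C (lam i)).coprime_iff_not_dvd.mpr ?_
  rw [Polynomial.dvd_iff_isRoot, Polynomial.IsRoot.def, eval_sum_C_mul_nodal_erase K s lam A hi]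
  exact mul_ne_zero (hA i hi) (Lagrange.eval_nodal_not_at_node fun k hk h => (Finset.mem_erase.mp hk).1 (hinj (Finset.mem_erase.mp hk).2 hi h.symm))

/-- for nodes injective on `s`: **`nodal s λ ∣ X^T − 1 ↔ ∀ i ∈ s, λ_i^T = 1`** (the linear factors are pairwise coprime). Any field. -/
theorem nodal_dvd_X_pow_sub_one_iff {ι : Type*} (s : Finset ι) (lam : ι → K) (hinj : Set.InjOn lam s) (T : ℕ) :
    Lagrange.nodal s lam ∣ Polynomial.X ^ T - 1 ↔ ∀ i ∈ s, lam i ^ T = 1 := by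
  have key : ∀ i, Polynomial.X - C (lam i) ∣ Polynomial.X ^ T - 1 ↔ lam i ^ T = 1 := fun i => by
    rw [Polynomial.dvd_iff_isRoot, Polynomial.IsRoot.def, Polynomial.eval_sub, Polynomial.eval_pow, Polynomial.eval_X, Polynomial.eval_one, sub_eq_zero]
  constructor
  · intro h i hi
    exact (key i).mp ((Lagrange.X_sub_C_dvd_nodal lam hi).trans h)
  · intro h
    rw [Lagrange.nodal]
    refine Finset.prod_dvd_of_coprime (fun i hi j hj hij => ?_) (fun i hi => (key i).mpr (h i hi))
    exact Polynomial.isCoprime_X_sub_C_of_isUnit_sub (sub_ne_zero.mpr fun h' => hij (hinj hi hj h')).isUnit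

/-- **A SUM OF EXPONENTIALS WITH DISTINCT NODES AND NON-ZERO WEIGHTS IS `T`-PERIODIC IFF EVERY NODE IS A `T`-TH ROOT OF UNITY** (`Finset` form; any field). -/
theorem periodic_sum_mul_pow_iff {ι : Type*} [DecidableEq ι] (s : Finset ι) (lam A : ι → K) (hinj : Set.InjOn lam s) (hA : ∀ i ∈ s, A i ≠ 0) (T : ℕ) :
    Function.Periodic (fun j => ∑ i ∈ s, A i * lam i ^ j) T ↔ ∀ i ∈ s, lam i ^ T = 1 := by
  rw [sum_mul_pow_eq_dualSeq_nodal K s lam A, periodic_dualSeq_iff_dvd K Lagrange.nodal_monic (isCoprime_nodal_sum_C_mul_nodal_erase K s lam A hinj hA),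
    nodal_dvd_X_pow_sub_one_iff K s lam hinj]

/-- **`secSeq A λ` (distinct nodes, non-zero weights) is `T`-periodic iff `λ_i^T = 1` for every `i`** (`Fin r` form; any field). -/
theorem periodic_secSeq_iff {r : ℕ} (A lam : Fin r → K) (hinj : Function.Injective lam) (hA : ∀ i, A i ≠ 0) (T : ℕ) :
    Function.Periodic (secSeq K A lam) T ↔ ∀ i, lam i ^ T = 1 := by
  rw [secSeq_eq_dualSeq_nodal K A lam, periodic_dualSeq_iff_dvd K Lagrange.nodal_monic
    (isCoprime_nodal_sum_C_mul_nodal_erase K Finset.univ lam A hinj.injOn fun i _ => hA i), nodal_dvd_X_pow_sub_one_iff K Finset.univ lam hinj.injOn]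
  simp only [Finset.mem_univ, forall_const]

end Summit.Ventures.HSemireg.Wedge.HankelOuter
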